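import Mathlib
import HarnessLib
import Literature.AlgebraicGeometry.Resolution.AffineBlowupUniversal
import Literature.AlgebraicGeometry.Resolution.AffineBlowupCartier
import Literature.AlgebraicGeometry.Resolution.AffineBlowupAlgebra
import Summits.ResolutionOfSingularities.ResolutionOfSingularities.Theorems.HomologicalConductorSurfaceTerminationChartSections
import Summits.ResolutionOfSingularities.ResolutionOfSingularities.Theorems.HomologicalConductorNoZenoStageRational

/-!
# Route `HomologicalConductor`, kill test `SurfaceTermination` (stmt-ResolutionOfSingularities-16488):
# the chart dictionary of a resolution, part 2 — the preimage of a chart of the blowing up, its proper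
# birational morphism to `Spec` of the normalised chart ring, and the resolution of the localised stage

OURS (cell res-hironaka, crux chain W4.4, seat res-L0-w44-stub-1; object U2a «chart dictionary» (K2) of
res-D-pv-045's programme `stub_pgNonincreasing`, PG-LERAY-NOTE §1; res-L0-w44-plan-1 (ρ13a)); nothing here
is a statement of the manuscript under review (Hironaka 2017); AI-written, weaker than expert review.
SUPPORT-level (kill test K4.4-s), counted 0.

Setting: `T ⊆ K` a `k`-subalgebra with `Frac T = K`, `I ⊆ T` an ideal, `x ∈ I` non-zero, `ρ : Z ⟶ Spec T`
with `Z` integral and `K(Z) ≃ K` over `T` (`e`, `he`), and a morphism `σ_B : Z ⟶ Bl_I(Spec T) =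
affineBlowup I` over `Spec T` (for a resolution `ρ` with `I · 𝒪_Z` invertible, `σ_B` is the lift of
`Blowups.IsBlowup.lift`).  Let `V := σ_B⁻¹(D₊(xt)) ⊆ Z` be the preimage of the chart of `x`, and
`C := k[T ∪ I·x⁻¹] ⊆ K` the affine chart ring, `N := nrm C` its normalisation inside `K`.

* §1 the chart functions: every element of the chart ring `(T[It])_{(xt)} ≅ T[I/x]` is a function on `V`
  whose value lies in `C` and in every `𝒪_{Z,z}`, `z ∈ V`; in particular `c · x⁻¹ ∈ 𝒪_{Z,z}` for `c ∈ I`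
  (`mul_inv_mem_stalkSubring_of_mem_preimage_chart`), and `ρ⁻¹(D(x)) ⊆ V`
  (`preimage_basicOpen_le_preimage_chart`);
* §2 for `Z` regular on `V`: `N ⊆ 𝒪_{Z,z}` for `z ∈ V` (`nrm_adjoin_le_stalkSubring`);
* §3 THE CHART MORPHISM `σ : V ⟶ Spec N` over `Spec T`, for any `k`-subalgebra `N` with `C ⊆ N ⊆ 𝒪_{Z,z}`
  (`z ∈ V`) — e.g. `N = nrm C` — (part 1's `exists_toSpec_of_forall_mem_stalkSubring`), PROPER when `ρ` is:
  `σ` followed by the affine `Spec N → Spec (T[It])_{(xt)}` (the value map `exists_chartRingHom`) is the base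
  change of `σ_B` to the chart (`exists_chartHom`), by rigidity — `exists_chartMorphism`.

Part 3 (`…ChartResolutionBirational`) adds: `σ` is birational when `ρ` is and `T` is integrally closed, and
the base change of `σ` to a localisation `N'` of `N` (e.g. `N' = loc O (nrm C) = T_(m+2)`, tree
`PersistenceRadicalTower.tower_succ_eq_loc_nrm_affChart`) is a resolution of `Spec N'` — the resolution of the
next stage consumed by U2e in the binder shape of `CechLocalization.isLocalizedModule_cechComapH1` (U2b).

Def-free; every object is a hypothesis or an `∃`.

References: The Stacks Project, Tags 0804, 02OS, 01RN [`StacksProject`]; U. Görtz, T. Wedhorn,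
*Algebraic Geometry I* (2020), Prop. 3.29, (13.19), Prop. 13.92 [`GortzWedhorn2020`]; O. Zariski, P. Samuel,
*Commutative Algebra* II (1960), Ch. VI §17 [`ZariskiSamuel1960`].
-/

noncomputable section

-- single-problem summit: the doubled namespace component `ResolutionOfSingularities` is forced
set_option linter.dupNamespace false

namespace Summit.ResolutionOfSingularities.ResolutionOfSingularities.Theorems.SurfaceTermination.ChartResolution

open CategoryTheory CategoryTheory.Limits AlgebraicGeometry TopologicalSpace Opposite
open Literature.AlgebraicGeometry.Resolution Literature.AlgebraicGeometry.Motives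
open Summit.ResolutionOfSingularities.ResolutionOfSingularities.Theorems.NoZeno.Birth
open Summit.ResolutionOfSingularities.ResolutionOfSingularities.Theorems.NoZeno.SandwichCluster
open Summit.ResolutionOfSingularities.ResolutionOfSingularities.Theorems.SurfaceTermination.CentreRing

variable {k K : Type} [Field k] [Field K] [Algebra k K]
variable (T : Subalgebra k K) {Z : Scheme.{0}} [IsIntegral Z] (ρ : Z ⟶ Spec (.of ↥T))
  (e : ↑Z.functionField ≃+* K) (he : ∀ t : ↥T, e (baseToFunctionField ρ t) = (t : K))
  {I : Ideal ↥T} (σB : Z ⟶ affineBlowup I) (hσB : σB ≫ affineBlowup.π I = ρ)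
  {x : ↥T} (hxI : x ∈ I)

/-! ## §1 The chart functions on `V = σ_B⁻¹(D₊(xt))` -/

section ChartFunctions

/-- The range of the chart `Spec (T[It])_{(xt)} → Bl_I` is the chart open `D₊(xt)`. [folklore] -/
theorem range_chartι_eq :
    Set.range (affineBlowup.chartι (I := I) x hxI) =
      Set.range ((affineBlowup.chartOpen x hxI).1.ι) := by
  rw [Scheme.Opens.range_ι]
  change Set.range _ = SetLike.coe (affineBlowup.chartι (I := I) x hxI ''ᵁ ⊤)
  rw [Scheme.Hom.image_top_eq_opensRange]
  rfl

include hσB in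
omit [IsIntegral Z] in
/-- `σ_B` is proper when `ρ` is (the blowing up is separated over `Spec T`). [folklore] -/
theorem isProper_of_comp [IsProper ρ] : IsProper σB := by
  haveI : IsProper (σB ≫ affineBlowup.π I) := by rw [hσB]; infer_instance
  exact IsProper.of_comp σB (affineBlowup.π I)

include hσB in
omit [IsIntegral Z] in
/-- **`ρ⁻¹(D(x)) ⊆ V`**: over `D(x)` the blowing up is the chart `D₊(xt)` (tree
`affineBlowup.preimage_basicOpen_le`). [cite: StacksProject, Tag 0804] -/
theorem preimage_basicOpen_le_preimage_chart :
    ρ ⁻¹ᵁ PrimeSpectrum.basicOpen x ≤ σB ⁻¹ᵁ (affineBlowup.chartOpen x hxI).1 := by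
  intro z hz
  rw [← hσB] at hz
  change σB z ∈ affineBlowup.chartι (I := I) x hxI ''ᵁ ⊤
  rw [affineBlowup.image_top_chartι]
  exact affineBlowup.preimage_basicOpen_le x hxI hz

variable (τ : ((σB ⁻¹ᵁ (affineBlowup.chartOpen x hxI).1 : Z.Opens) : Scheme.{0}) ⟶
    Spec (.of (HomogeneousLocalization.Away (reesGrading I) (reesT x hxI))))
  (hτ : τ ≫ affineBlowup.chartι x hxI = (σB ⁻¹ᵁ (affineBlowup.chartOpen x hxI).1).ι ≫ σB)

include hσB

omit [IsIntegral Z] in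
/-- **The chart morphism `τ : V ⟶ Spec (T[It])_{(xt)}`** (restriction of `σ_B` to the chart, followed by
the identification of the chart open with the spectrum of the chart ring) exists, and is proper when
`ρ` is. [cite: StacksProject, Tag 0804] -/
theorem exists_chartHom [IsProper ρ] :
    ∃ τ : ((σB ⁻¹ᵁ (affineBlowup.chartOpen x hxI).1 : Z.Opens) : Scheme.{0}) ⟶
        Spec (.of (HomogeneousLocalization.Away (reesGrading I) (reesT x hxI))),
      τ ≫ affineBlowup.chartι x hxI = (σB ⁻¹ᵁ (affineBlowup.chartOpen x hxI).1).ι ≫ σB ∧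
        IsProper τ := by
  haveI := isProper_of_comp T ρ σB hσB
  let eU := IsOpenImmersion.isoOfRangeEq (affineBlowup.chartι (I := I) x hxI)
    (affineBlowup.chartOpen x hxI).1.ι (range_chartι_eq T hxI)
  have heU : eU.inv ≫ affineBlowup.chartι x hxI = (affineBlowup.chartOpen x hxI).1.ι :=
    IsOpenImmersion.isoOfRangeEq_inv_fac _ _ _
  refine ⟨(σB ∣_ (affineBlowup.chartOpen x hxI).1) ≫ eU.inv, ?_, inferInstance⟩
  rw [Category.assoc, heU, morphismRestrict_ι]

include hτ he in
-- the chart algebra `(T[It])_{(xt)}` is a homogeneous localisation of a subalgebra of `T[X]`: instance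
-- unification on it is slow (same phenomenon as p509910 / `…NatCarrierDeltaComap`), hence the budget
set_option maxHeartbeats 400000 in
/-- **Values of the chart functions, I: the structure functions.** Under `τ`, the element `t/1` of the
chart ring becomes a section of `V` with value `t ∈ K` (`τ` lies over `Spec T`). [folklore] -/
theorem sectionVal_chartHom_reesChartBase (hη : genericPoint Z ∈ (σB ⁻¹ᵁ (affineBlowup.chartOpen x hxI).1).ι ''ᵁ ⊤)
    (t : ↥T) :
    e (Z.presheaf.germ _ (genericPoint Z) hη (τ.appTop ((Scheme.ΓSpecIso
      (.of (HomogeneousLocalization.Away (reesGrading I) (reesT x hxI)))).inv (reesChartBase x hxI t)))) =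
      (t : K) := by
  -- `τ ≫ Spec (T → chart ring) = V.ι ≫ ρ`
  have hcomp : τ ≫ Spec.map (CommRingCat.ofHom (reesChartBase x hxI)) =
      (σB ⁻¹ᵁ (affineBlowup.chartOpen x hxI).1).ι ≫ ρ := by
    rw [← affineBlowup.chartι_π, ← Category.assoc, hτ, Category.assoc, hσB]
  have hnat : (Spec.map (CommRingCat.ofHom (reesChartBase x hxI))).appTop
      ((Scheme.ΓSpecIso (.of ↥T)).inv t) =
        (Scheme.ΓSpecIso (.of (HomogeneousLocalization.Away (reesGrading I) (reesT x hxI)))).inv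
          (reesChartBase x hxI t) := by
    change ((Scheme.ΓSpecIso (.of ↥T)).inv ≫ (Spec.map (CommRingCat.ofHom (reesChartBase x hxI))).appTop) t = _
    rw [← Scheme.ΓSpecIso_inv_naturality]
    rfl
  have key := congrArg (fun φ => φ.appTop ((Scheme.ΓSpecIso (.of ↥T)).inv t)) hcomp
  simp only [Scheme.Hom.comp_appTop, CommRingCat.comp_apply] at key
  have h1 := congrArg (fun u => e (Z.presheaf.germ _ (genericPoint Z) hη (τ.appTop u))) hnat
  have h2 := congrArg (fun u => e (Z.presheaf.germ _ (genericPoint Z) hη u)) key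
  exact h1.symm.trans (h2.trans (sectionVal_ι_comp e T ρ he _ hη t))

include hτ he in
/-- **Values of the chart functions, II.** Every element `a` of the chart ring `(T[It])_{(xt)} ≅ T[I/x]`
becomes under `τ` a section of `V` whose value in `K` lies in the affine chart ring `C = k[T ∪ I·x⁻¹]` and
is computed by `a ↦ reesChartEquiv a ∈ T[I/x] ⊆ T[1/x] → K`; precisely: there is a ring map
`w : (T[It])_{(xt)} → K` with `w (t/1) = t`, `w ((ct)/(xt)) · x = c`, all of whose values are values of
sections of `V` and lie in `C`. We record the two consequences used below. (a) `c · x⁻¹` is the value of a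
section of `V`, for `c ∈ I`. [cite: StacksProject, Tag 0804] -/
theorem exists_section_val_eq_mul_inv (hη : genericPoint Z ∈ (σB ⁻¹ᵁ (affineBlowup.chartOpen x hxI).1).ι ''ᵁ ⊤)
    (hx0 : (x : K) ≠ 0) (c : ↥T) (hc : c ∈ I) :
    ∃ s : Γ(σB ⁻¹ᵁ (affineBlowup.chartOpen x hxI).1, ⊤),
      e (Z.presheaf.germ _ (genericPoint Z) hη s) = (c : K) * (x : K)⁻¹ := by
  -- the value ring map `v : chart ring → K`
  let A := HomogeneousLocalization.Away (reesGrading I) (reesT x hxI)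
  let v : A →+* K := (e.toRingHom.comp (Z.presheaf.germ _ (genericPoint Z) hη).hom).comp
    (τ.appTop.hom.comp (Scheme.ΓSpecIso (.of A)).inv.hom)
  have hv : ∀ a : A, v a = e (Z.presheaf.germ _ (genericPoint Z) hη
      (τ.appTop ((Scheme.ΓSpecIso (.of A)).inv a))) := fun a => rfl
  have hvT : ∀ t : ↥T, v (reesChartBase x hxI t) = (t : K) := fun t => by
    rw [hv]; exact sectionVal_chartHom_reesChartBase T ρ e he σB hσB hxI τ hτ hη t
  -- the element `(ct)/(xt)` via `reesChartEquiv`: `g * (x/1) = c/1` in the chart ring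
  let g : A := (reesChartEquiv x hxI).symm ⟨_, div_mem_blowupAlgebra I x hc⟩
  have hg : g * reesChartBase x hxI x = reesChartBase x hxI c := by
    apply (reesChartEquiv x hxI).injective
    rw [map_mul, reesChartEquiv_reesChartBase, reesChartEquiv_reesChartBase, RingEquiv.apply_symm_apply]
    exact Subtype.ext (div_mul_algebraMap x c)
  refine ⟨τ.appTop ((Scheme.ΓSpecIso (.of A)).inv g), ?_⟩
  rw [← hv, eq_mul_inv_iff_mul_eq₀ hx0, ← hvT x, ← map_mul, hg, hvT]

include hτ he in
/-- (b) **`c · x⁻¹ ∈ 𝒪_{Z,z}` for every `z ∈ V` and `c ∈ I`** (values of sections lie in the local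
rings). [cite: StacksProject, Tag 0804; ZariskiSamuel1960, Ch. VI §17] -/
theorem mul_inv_mem_stalkSubring_of_mem_preimage_chart (hx0 : (x : K) ≠ 0) (c : ↥T) (hc : c ∈ I)
    (z : Z) (hz : z ∈ σB ⁻¹ᵁ (affineBlowup.chartOpen x hxI).1) :
    (c : K) * (x : K)⁻¹ ∈ ((RatFn.toFunctionField z).range).map e.toRingHom := by
  have hη := genericPoint_mem_image_top (σB ⁻¹ᵁ (affineBlowup.chartOpen x hxI).1) ⟨z, hz⟩
  obtain ⟨s, hs⟩ := exists_section_val_eq_mul_inv T ρ e he σB hσB hxI τ hτ hη hx0 c hc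
  rw [← hs]
  exact sectionVal_mem_stalkSubring e _ hη s z hz

include hτ he in
/-- **The affine chart ring lies in the local rings**: `C = k[T ∪ I·x⁻¹] ⊆ 𝒪_{Z,z}` for `z ∈ V`.
[cite: ZariskiSamuel1960, Ch. VI §17] -/
theorem adjoin_le_stalkSubring (hx0 : (x : K) ≠ 0) (z : Z)
    (hz : z ∈ σB ⁻¹ᵁ (affineBlowup.chartOpen x hxI).1) :
    (Algebra.adjoin k ((T : Set K) ∪ {y : K | ∃ c : ↥T, c ∈ I ∧ y = (c : K) * (x : K)⁻¹}) : Set K) ⊆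
      ((RatFn.toFunctionField z).range).map e.toRingHom := by
  have hT : (T : Set K) ⊆ ((RatFn.toFunctionField z).range).map e.toRingHom :=
    fun t ht => toSubring_le_stalkSubring T ρ e he z (Subalgebra.mem_toSubring.mpr ht)
  intro y hy
  induction hy using Algebra.adjoin_induction with
  | mem y hy =>
    rcases hy with hy | ⟨c, hc, rfl⟩
    · exact hT hy
    · exact mul_inv_mem_stalkSubring_of_mem_preimage_chart T ρ e he σB hσB hxI τ hτ hx0 c hc z hz
  | algebraMap r => exact hT (T.algebraMap_mem r)
  | add a b _ _ ha hb => exact Subring.add_mem _ ha hb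
  | mul a b _ _ ha hb => exact Subring.mul_mem _ ha hb

include hτ he in
-- the chart algebra `(T[It])_{(xt)} ≅ blowupAlgebra` is a (homogeneous) localisation of a subalgebra of
-- `T[X]`: instance unification on it is slow (same phenomenon as p509910 / `…NatCarrierDeltaComap`)
set_option maxHeartbeats 800000 in
/-- **Values of the chart functions, III: the value map into a subring.**  If the `k`-subalgebra `N ⊆ K`
contains `T` and the `c · x⁻¹`, `c ∈ I`, then taking a chart function to its value defines a ring map
`ψ : (T[It])_{(xt)} → N` — the value of `a` is that of `reesChartEquiv a ∈ T[I/x] = T[c/x : c ∈ I]`, a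
polynomial in the `c · x⁻¹` over `T` (tree `AffineBlowupAlgebra`: `reesChartEquiv`, `blowupAlgebra = adjoin`).
[cite: StacksProject, Tag 0804] -/
theorem exists_chartRingHom (hη : genericPoint Z ∈ (σB ⁻¹ᵁ (affineBlowup.chartOpen x hxI).1).ι ''ᵁ ⊤)
    (hx0 : (x : K) ≠ 0) (N : Subalgebra k K) (hTN : T ≤ N)
    (hIN : ∀ c : ↥T, c ∈ I → (c : K) * (x : K)⁻¹ ∈ N) :
    ∃ ψ : CommRingCat.of (HomogeneousLocalization.Away (reesGrading I) (reesT x hxI)) ⟶ CommRingCat.of ↥N,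
      ∀ a, ((ψ.hom a : ↥N) : K) = e (Z.presheaf.germ _ (genericPoint Z) hη
        (τ.appTop ((Scheme.ΓSpecIso (.of (HomogeneousLocalization.Away (reesGrading I) (reesT x hxI)))).inv a))) := by
  have hCN : (Algebra.adjoin k ((T : Set K) ∪ {y : K | ∃ c : ↥T, c ∈ I ∧ y = (c : K) * (x : K)⁻¹})) ≤ N := by
    refine Algebra.adjoin_le ?_
    rintro y (hy | ⟨c, hc, rfl⟩)
    · exact hTN hy
    · exact hIN c hc
  -- the value map `v`
  have hexv : ∃ v : (HomogeneousLocalization.Away (reesGrading I) (reesT x hxI)) →+* K, ∀ a, v a = e (Z.presheaf.germ _ (genericPoint Z) hη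
      (τ.appTop ((Scheme.ΓSpecIso (.of (HomogeneousLocalization.Away (reesGrading I) (reesT x hxI)))).inv a))) :=
    ⟨(e.toRingHom.comp (Z.presheaf.germ _ (genericPoint Z) hη).hom).comp
      (τ.appTop.hom.comp (Scheme.ΓSpecIso (.of (HomogeneousLocalization.Away (reesGrading I) (reesT x hxI)))).inv.hom), fun a => rfl⟩
  obtain ⟨v, hv⟩ := hexv
  have hvT : ∀ t : ↥T, v (reesChartBase x hxI t) = (t : K) := fun t => by
    rw [hv]; exact sectionVal_chartHom_reesChartBase T ρ e he σB hσB hxI τ hτ hη t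
  -- its values lie in `C = k[T ∪ I·x⁻¹]`: induction over `T[I/x] = T[c/x : c ∈ I]`
  have hvC : ∀ b : ↥(blowupAlgebra I x), v ((reesChartEquiv x hxI).symm b) ∈ (Algebra.adjoin k ((T : Set K) ∪ {y : K | ∃ c : ↥T, c ∈ I ∧ y = (c : K) * (x : K)⁻¹})) := by
    rintro ⟨b, hb⟩
    induction hb using Algebra.adjoin_induction with
    | mem b hb =>
      obtain ⟨c, hc, rfl⟩ := hb
      -- `v` of the generator `c/x` is `c · x⁻¹`, since `(c/x) · x = c` in the chart ring
      have hg : (reesChartEquiv x hxI).symm ⟨_, div_mem_blowupAlgebra I x hc⟩ * reesChartBase x hxI x =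
          reesChartBase x hxI c := by
        apply (reesChartEquiv x hxI).injective
        rw [map_mul, reesChartEquiv_reesChartBase, reesChartEquiv_reesChartBase, RingEquiv.apply_symm_apply]
        exact Subtype.ext (div_mul_algebraMap x c)
      have hval : v ((reesChartEquiv x hxI).symm ⟨_, div_mem_blowupAlgebra I x hc⟩) =
          (c : K) * (x : K)⁻¹ := by
        rw [eq_mul_inv_iff_mul_eq₀ hx0, ← hvT x, ← map_mul, hg, hvT]
      rw [hval]
      exact Algebra.subset_adjoin (Or.inr ⟨c, hc, rfl⟩)
    | algebraMap t =>
      have h1 : (reesChartEquiv x hxI).symm ⟨algebraMap ↥T (Localization.Away x) t,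
          Subalgebra.algebraMap_mem _ t⟩ = reesChartBase x hxI t := by
        apply (reesChartEquiv x hxI).injective
        rw [RingEquiv.apply_symm_apply, reesChartEquiv_reesChartBase]
        rfl
      rw [h1, hvT]
      exact Algebra.subset_adjoin (Or.inl t.2)
    | add a b ha hb iha ihb =>
      have h1 : (reesChartEquiv x hxI).symm ⟨a + b, Subalgebra.add_mem _ ha hb⟩ =
          (reesChartEquiv x hxI).symm ⟨a, ha⟩ + (reesChartEquiv x hxI).symm ⟨b, hb⟩ :=
        (reesChartEquiv x hxI).symm.map_add ⟨a, ha⟩ ⟨b, hb⟩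
      rw [h1, v.map_add]
      exact Subalgebra.add_mem _ iha ihb
    | mul a b ha hb iha ihb =>
      have h1 : (reesChartEquiv x hxI).symm ⟨a * b, Subalgebra.mul_mem _ ha hb⟩ =
          (reesChartEquiv x hxI).symm ⟨a, ha⟩ * (reesChartEquiv x hxI).symm ⟨b, hb⟩ :=
        (reesChartEquiv x hxI).symm.map_mul ⟨a, ha⟩ ⟨b, hb⟩
      rw [h1, v.map_mul]
      exact Subalgebra.mul_mem _ iha ihb
  have hvN : ∀ a : (HomogeneousLocalization.Away (reesGrading I) (reesT x hxI)), v a ∈ N := by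
    intro a
    have hmem := hvC (reesChartEquiv x hxI a)
    rw [RingEquiv.symm_apply_apply] at hmem
    exact hCN hmem
  exact ⟨CommRingCat.ofHom (v.codRestrict N hvN), fun a => (hv a)⟩

end ChartFunctions

/-! ## §2 The normalised chart ring lies in the local rings of a regular `V` -/

section Normalised

variable (τ : ((σB ⁻¹ᵁ (affineBlowup.chartOpen x hxI).1 : Z.Opens) : Scheme.{0}) ⟶
    Spec (.of (HomogeneousLocalization.Away (reesGrading I) (reesT x hxI))))
  (hτ : τ ≫ affineBlowup.chartι x hxI = (σB ⁻¹ᵁ (affineBlowup.chartOpen x hxI).1).ι ≫ σB)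

include hσB hτ he in
/-- **`N = nrm (k[T ∪ I·x⁻¹]) ⊆ 𝒪_{Z,z}` for `z ∈ V` with `𝒪_{Z,z}` regular** (and `Frac T = K`): the affine
chart ring lies in `𝒪_{Z,z}` (§1) and the regular local ring `𝒪_{Z,z}` is integrally closed in `K`
(stub-4's `CentreRing.mem_of_isIntegral`). [cite: ZariskiSamuel1960, Ch. VI §17] -/
theorem nrm_adjoin_le_stalkSubring [IsFractionRing ↥T K] (hx0 : (x : K) ≠ 0) (z : Z)
    (hz : z ∈ σB ⁻¹ᵁ (affineBlowup.chartOpen x hxI).1) [IsRegularLocalRing (Z.presheaf.stalk z)] :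
    (nrm (Algebra.adjoin k ((T : Set K) ∪ {y : K | ∃ c : ↥T, c ∈ I ∧ y = (c : K) * (x : K)⁻¹})) : Set K) ⊆
      ((RatFn.toFunctionField z).range).map e.toRingHom := by
  -- `𝒪_{Z,z} ⊆ K` as a `k`-subalgebra
  let S : Subalgebra k K :=
    { toSubsemiring := (((RatFn.toFunctionField z).range).map e.toRingHom).toSubsemiring
      algebraMap_mem' := fun c =>
        toSubring_le_stalkSubring T ρ e he z (Subalgebra.mem_toSubring.mpr (T.algebraMap_mem c)) }
  have hS : S.toSubring = ((RatFn.toFunctionField z).range).map e.toRingHom :=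
    SetLike.coe_injective rfl
  have hCS : Algebra.adjoin k ((T : Set K) ∪ {y : K | ∃ c : ↥T, c ∈ I ∧ y = (c : K) * (x : K)⁻¹}) ≤ S :=
    fun y hy => adjoin_le_stalkSubring T ρ e he σB hσB hxI τ hτ hx0 z hz hy
  change nrm _ ≤ S
  refine Algebra.adjoin_le ?_
  rintro y ⟨p, hp, hpy⟩
  refine mem_of_isIntegral T ρ e he z S hS y ⟨p.map (Subalgebra.inclusion hCS).toRingHom, hp.map _, ?_⟩
  have hcomp : (algebraMap ↥S K).comp (Subalgebra.inclusion hCS).toRingHom =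
      algebraMap ↥(Algebra.adjoin k ((T : Set K) ∪
        {y : K | ∃ c : ↥T, c ∈ I ∧ y = (c : K) * (x : K)⁻¹})) K := RingHom.ext fun _ => rfl
  rw [Polynomial.eval₂_map, hcomp]
  exact hpy

end Normalised

/-! ## §3 The chart morphism `σ : V ⟶ Spec N` -/

section ChartMorphism

/-- `T ≤ N = nrm (k[T ∪ I·x⁻¹])`. [folklore] -/
theorem le_nrm_adjoin :
    T ≤ nrm (Algebra.adjoin k ((T : Set K) ∪ {y : K | ∃ c : ↥T, c ∈ I ∧ y = (c : K) * (x : K)⁻¹})) := by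
  intro t ht
  have ht' : t ∈ Algebra.adjoin k ((T : Set K) ∪
      {y : K | ∃ c : ↥T, c ∈ I ∧ y = (c : K) * (x : K)⁻¹}) := Algebra.subset_adjoin (Or.inl ht)
  exact Algebra.subset_adjoin (isIntegral_algebraMap (A := K) (x := (⟨t, ht'⟩ : ↥(Algebra.adjoin k _))))

include hσB he in
-- slow instance unification on the chart algebra, as above
set_option maxHeartbeats 800000 in
/-- **The chart morphism `σ : V ⟶ Spec N`.**  Let `N ⊆ K` be a `k`-subalgebra containing `T` and the
`c · x⁻¹`, `c ∈ I` (so `N ⊇ C = k[T ∪ I·x⁻¹]`), and contained in every `𝒪_{Z,z}`, `z ∈ V = σ_B⁻¹(D₊(xt))`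
(for `N = nrm C` and `V` regular this is `nrm_adjoin_le_stalkSubring`).  Then there is `σ : V ⟶ Spec N` with
`σ^*(y)` of value `y`, lying over `Spec T` (`V.ι ≫ ρ = σ ≫ Spec (T → N)`), and PROPER when `ρ` is: `σ`
followed by the affine, hence separated, `Spec N ⟶ Spec (T[It])_{(xt)}` (the ring map taking a chart
function to its value, which lies in `C ⊆ N`) is the proper chart morphism `τ` (rigidity), so Mathlib's
`IsProper.of_comp` applies. [cite: StacksProject, Tag 0804; GortzWedhorn2020, Prop. 3.29] -/
theorem exists_chartMorphism [IsProper ρ] (hx0 : (x : K) ≠ 0)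
    (hne : ((σB ⁻¹ᵁ (affineBlowup.chartOpen x hxI).1 : Z.Opens) : Set Z).Nonempty)
    (N : Subalgebra k K) (hTN : T ≤ N) (hIN : ∀ c : ↥T, c ∈ I → (c : K) * (x : K)⁻¹ ∈ N)
    (hNz : ∀ z ∈ σB ⁻¹ᵁ (affineBlowup.chartOpen x hxI).1, ∀ y ∈ N,
      y ∈ ((RatFn.toFunctionField z).range).map e.toRingHom) :
    ∃ σ : ((σB ⁻¹ᵁ (affineBlowup.chartOpen x hxI).1 : Z.Opens) : Scheme.{0}) ⟶ Spec (.of ↥N),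
      (∀ y, e (Z.presheaf.germ _ (genericPoint Z)
          (genericPoint_mem_image_top (σB ⁻¹ᵁ (affineBlowup.chartOpen x hxI).1) hne)
          (σ.appTop ((Scheme.ΓSpecIso (.of ↥N)).inv y))) = (y : K)) ∧
      (σB ⁻¹ᵁ (affineBlowup.chartOpen x hxI).1).ι ≫ ρ =
        σ ≫ Spec.map (CommRingCat.ofHom (Subalgebra.inclusion hTN).toRingHom) ∧
      IsProper σ := by
  have hη := genericPoint_mem_image_top (σB ⁻¹ᵁ (affineBlowup.chartOpen x hxI).1) hne
  -- the chart morphism `τ` and the value map `ψ : chart ring → N`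
  obtain ⟨τ, hτ, hτp⟩ := exists_chartHom T ρ σB hσB hxI
  obtain ⟨ψ, hψ⟩ := exists_chartRingHom T ρ e he σB hσB hxI τ hτ hη hx0 N hTN hIN
  -- the morphism `σ`
  obtain ⟨σ, hσ⟩ := exists_toSpec_of_forall_mem_stalkSubring e N (σB ⁻¹ᵁ (affineBlowup.chartOpen x hxI).1) hη hNz
  refine ⟨σ, hσ, ι_comp_eq_comp_specMap_of_sectionVal e T ρ he N hTN (σB ⁻¹ᵁ (affineBlowup.chartOpen x hxI).1) hη σ hσ, ?_⟩
  -- `σ ≫ Spec ψ = τ` by rigidity, hence `σ` is proper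
  have hσψ : σ ≫ Spec.map ψ = τ := by
    refine hom_ext_of_sectionVal e (σB ⁻¹ᵁ (affineBlowup.chartOpen x hxI).1) hη _ _ fun a => ?_
    have hnat := congrArg (fun φ => φ.hom a) (Scheme.ΓSpecIso_inv_naturality ψ)
    simp only [CommRingCat.hom_comp, RingHom.coe_comp, Function.comp_apply] at hnat
    -- hnat : (ΓSpecIso N).inv (ψ a) = (Spec.map ψ).appTop ((ΓSpecIso A).inv a)
    rw [Scheme.Hom.comp_appTop, CommRingCat.comp_apply]
    erw [← hnat]
    rw [hσ (ψ.hom a)]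
    exact hψ a
  haveI : IsProper (σ ≫ Spec.map ψ) := by rw [hσψ]; exact hτp
  exact IsProper.of_comp σ (Spec.map ψ)

end ChartMorphism

end Summit.ResolutionOfSingularities.ResolutionOfSingularities.Theorems.SurfaceTermination.ChartResolution

end
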